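import Summits.Ventures.LatticeQCDFlow.Scaling.IdealStarMixingCeiling
import Literature.Probability.MarkovChains.SeparationDistance

/-!
HONEST FRAMING: exact (Metropolis-corrected) sampling algorithms for lattice gauge theory; figures
of merit are autocorrelation/cost numbers at stated couplings and volumes; no continuum-physics
claim.

# IdealStarSeparation — THE FRESHNESS MINORISATION IS A SEPARATION BOUND: FOR THE IDEALISED HOT-ONLY HUB
# `Pⁿ(x,z) ≥ (1 − (K+1)λⁿ/t)·π̃(z)` FOR ALL `x, z` (`λ = 1 − t(1−t)c/(2m)`), I.E. THE SEPARATION DISTANCE SATISFIES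
# `d(n) ≤ s(n) ≤ (K+1)λⁿ/t`, AND `s(n) ≤ ε` AFTER `(2m/(t(1−t)c))·log((K+1)/(tε))` STEPS (lean-2 GEN-24, ours)

Venture-side (OURS).  Cell `lqcd-flow` (pub-lqcd), unit `pub-lqcd-lean-2-g24`, 2026-08-27.  Chapter L (the coupon-collector
law from a cold start), file 17.  The minorisation `δ_x Pⁿ ≥ (δ_{univ}Qⁿ)(∅)·π̃` of `Scaling/IdealStarFreshness` is
uniform in the start, so it bounds Levin–Peres–Wilmer's SEPARATION DISTANCE `s(n) = max_{x,z}(1 − Pⁿ(x,z)/π̃(z))`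
(`Literature/…/SeparationDistance`, eqs. (6.6)–(6.7); `kernelAt P n x z = (δ_x Pⁿ)(z)` by definition), the
stronger currency behind strong stationary times: the idealised star is `ε`-uniform, not merely `ε`-close, at the
coupon-collector time.

## What is proved

* **`idealStar_kernelAt_ge`** — `Pⁿ(x,z) ≥ (1 − (δ_{univ}Qⁿ){D ≠ ∅})·π̃(z) ≥ (1 − (K+1)λⁿ/t)·π̃(z)`.
* **`idealStar_sepDist_le` (THE SEPARATION CEILING)** — `s(n) ≤ (K+1)·(1 − t(1−t)c/(2m))ⁿ/t`, and
  `idealStar_worstTvDist_le_sepDist` — `d(n) ≤ s(n)` (LPW Lemma 6.16 as typed) for the record;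
  **`idealStar_sepDist_le_of_ge_log`** — `n ≥ (2m/(t(1−t)c))·log((K+1)/(tε))` ⇒ `s(n) ≤ ε`.

Reading (no numerics implied): at the coupon-collector time every configuration has at least `(1−ε)` times its
equilibrium probability under the idealised star from every start — a Doeblin condition on the whole space reached in
`O(K·log K)` steps, so the chain forgets its start at that time in the strongest finite-state sense.  NOT CLAIMED:
imperfect transports or hot samplers; a separation FLOOR sharper than `d(n)` (the collector floor of chapter L applies
through `d ≤ s`).  Literature grade (cell rule): OWN COMPOSITION; nothing cited as a fact; no new bib keys.
-/

noncomputable section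

open Finset Function
open Literature.Probability.MarkovChains

namespace Summit.Ventures.LatticeQCDFlow.Scaling

variable {S : Type*} [Fintype S] [DecidableEq S] {K m : ℕ} {ν : S → ℝ} {M : Fin (K + 1) → S → S → ℝ} {t : ℝ}

section Sep
variable (κ : Fin m → Fin K)

/-- **`Pⁿ(x,z) ≥ (1 − (K+1)λⁿ/t)·π̃(z)`** for the idealised hot-only hub, every `x`, `z`, `n`. [ours] -/
theorem idealStar_kernelAt_ge (hm : 1 ≤ m) (ht0 : 0 < t) (ht1 : t < 1) (hν : ∀ v, 0 < ν v) (hν1 : ∑ v, ν v = 1)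
    (hM : ∀ k, IsRowStochastic (M k)) (hM0 : ∀ u v, M 0 u v = ν v) {c : ℕ} (hc1 : 1 ≤ c)
    (hc : ∀ p : Fin K, c ≤ (univ.filter (fun r : Fin m => κ r = p)).card) (hcm : c ≤ m) (n : ℕ)
    (x z : Fin (K + 1) → S) :
    (1 - ((K : ℝ) + 1) * (1 - t * (1 - t) * c / (2 * m)) ^ n / t) * tensorFun (fun _ : Fin (K + 1) => ν) z
      ≤ kernelAt (fun y z : Fin (K + 1) → S => t * ptGraphSwap (fun _ : Fin (K + 1) => ν)
          (fun r : Fin m => (((0 : Fin (K + 1)), (κ r).succ) : Fin (K + 1) × Fin (K + 1))) (fun _ => Equiv.refl S) y z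
          + (1 - t) * prodKernel (fun k : Fin (K + 1) => if k = 0 then (1 : ℝ) else 0) M y z) n x z := by
  set Q : Finset (Fin (K + 1)) → Finset (Fin (K + 1)) → ℝ := fun D D' => ∑ r : Fin m, t / m *
      (if D' = D.image (Equiv.swap (0 : Fin (K + 1)) (κ r).succ) then (1 : ℝ) else 0)
      + (1 - t) * (if D' = D.erase 0 then (1 : ℝ) else 0) with hQ_def
  have hQ : ∀ D D', Q D D' = ∑ r : Fin m, t / m * (if D' = D.image (Equiv.swap (0 : Fin (K + 1)) (κ r).succ) then (1 : ℝ)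
      else 0) + (1 - t) * (if D' = D.erase 0 then (1 : ℝ) else 0) := fun D D' => rfl
  have hstale := dirty_nonempty_le_tuned κ hm ht0 ht1 hQ hc1 hc hcm n
  have hQst := dirty_isRowStochastic κ hm ht0.le ht1.le hQ
  have hmassQ : ∑ D, lawAt Q (Pi.single (univ : Finset (Fin (K + 1))) 1) n D = 1 := by
    rw [sum_lawAt hQst, Finset.sum_pi_single', if_pos (mem_univ _)]
  have hsplit := Finset.sum_filter_add_sum_filter_not univ (fun D : Finset (Fin (K + 1)) => D ≠ ∅)
    (fun D => lawAt Q (Pi.single (univ : Finset (Fin (K + 1))) 1) n D)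
  have hE : univ.filter (fun D : Finset (Fin (K + 1)) => ¬D ≠ ∅) = {∅} := by
    ext D; simp only [Finset.mem_filter, Finset.mem_univ, true_and, not_not, Finset.mem_singleton]
  rw [hmassQ, hE, Finset.sum_singleton] at hsplit
  have hmin := ideal_minorization κ hm ht0.le ht1.le hν hν1 hM hM0 hQ x n z
  have hπ0 : 0 ≤ tensorFun (fun _ : Fin (K + 1) => ν) z := (tensorFun_pos (fun _ v => hν v) z).le
  unfold kernelAt
  calc (1 - ((K : ℝ) + 1) * (1 - t * (1 - t) * c / (2 * m)) ^ n / t) * tensorFun (fun _ : Fin (K + 1) => ν) z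
      ≤ lawAt Q (Pi.single (univ : Finset (Fin (K + 1))) 1) n ∅ * tensorFun (fun _ : Fin (K + 1) => ν) z :=
        mul_le_mul_of_nonneg_right (by linarith) hπ0
    _ ≤ _ := hmin

/-- **THE SEPARATION CEILING: `s(n) ≤ (K+1)·(1 − t(1−t)c/(2m))ⁿ/t`** for the idealised hot-only hub. [ours] -/
theorem idealStar_sepDist_le (hm : 1 ≤ m) (ht0 : 0 < t) (ht1 : t < 1) (hν : ∀ v, 0 < ν v) (hν1 : ∑ v, ν v = 1)
    (hM : ∀ k, IsRowStochastic (M k)) (hM0 : ∀ u v, M 0 u v = ν v) {c : ℕ} (hc1 : 1 ≤ c)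
    (hc : ∀ p : Fin K, c ≤ (univ.filter (fun r : Fin m => κ r = p)).card) (hcm : c ≤ m) (n : ℕ) :
    sepDist (fun y z : Fin (K + 1) → S => t * ptGraphSwap (fun _ : Fin (K + 1) => ν)
          (fun r : Fin m => (((0 : Fin (K + 1)), (κ r).succ) : Fin (K + 1) × Fin (K + 1))) (fun _ => Equiv.refl S) y z
          + (1 - t) * prodKernel (fun k : Fin (K + 1) => if k = 0 then (1 : ℝ) else 0) M y z)
        (tensorFun (fun _ : Fin (K + 1) => ν)) n
      ≤ ((K : ℝ) + 1) * (1 - t * (1 - t) * c / (2 * m)) ^ n / t := by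
  have hbound : 0 ≤ ((K : ℝ) + 1) * (1 - t * (1 - t) * c / (2 * m)) ^ n / t :=
    (worstTvDist_nonneg _ _ n).trans (idealStar_worstTvDist_le κ hm ht0 ht1 hν hν1 hM hM0 hc1 hc hcm n)
  refine Real.iSup_le (fun x => Real.iSup_le (fun z => ?_) hbound) hbound
  have hπpos : 0 < tensorFun (fun _ : Fin (K + 1) => ν) z := tensorFun_pos (fun _ v => hν v) z
  have h := idealStar_kernelAt_ge κ hm ht0 ht1 hν hν1 hM hM0 hc1 hc hcm n x z
  rw [sub_le_comm, le_div_iff₀ hπpos]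
  linarith

/-- `d(n) ≤ s(n)` for the idealised star (Levin–Peres–Wilmer Lemma 6.16, recorded). [ours] -/
theorem idealStar_worstTvDist_le_sepDist (ht0 : 0 ≤ t) (ht1 : t ≤ 1) (hν : ∀ v, 0 < ν v) (hν1 : ∑ v, ν v = 1)
    (hM : ∀ k, IsRowStochastic (M k)) (n : ℕ) :
    worstTvDist (fun y z : Fin (K + 1) → S => t * ptGraphSwap (fun _ : Fin (K + 1) => ν)
          (fun r : Fin m => (((0 : Fin (K + 1)), (κ r).succ) : Fin (K + 1) × Fin (K + 1))) (fun _ => Equiv.refl S) y z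
          + (1 - t) * prodKernel (fun k : Fin (K + 1) => if k = 0 then (1 : ℝ) else 0) M y z)
        (tensorFun (fun _ : Fin (K + 1) => ν)) n
      ≤ sepDist (fun y z : Fin (K + 1) → S => t * ptGraphSwap (fun _ : Fin (K + 1) => ν)
          (fun r : Fin m => (((0 : Fin (K + 1)), (κ r).succ) : Fin (K + 1) × Fin (K + 1))) (fun _ => Equiv.refl S) y z
          + (1 - t) * prodKernel (fun k : Fin (K + 1) => if k = 0 then (1 : ℝ) else 0) M y z)
        (tensorFun (fun _ : Fin (K + 1) => ν)) n := by
  have hμ : ∀ (k : Fin (K + 1)) (v : S), 0 < (fun _ : Fin (K + 1) => ν) k v := fun _ v => hν v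
  have hw0 : ∀ k : Fin (K + 1), 0 ≤ (if k = 0 then (1 : ℝ) else 0) := fun k => by split_ifs <;> norm_num
  have hw1 : ∑ k : Fin (K + 1), (if k = 0 then (1 : ℝ) else 0) = 1 := by
    rw [Finset.sum_ite_eq' univ (0 : Fin (K + 1)), if_pos (mem_univ _)]
  have hP := weightedScheme_isRowStochastic (t := t) (w := fun k : Fin (K + 1) => if k = 0 then (1 : ℝ) else 0)
    (ptGraphSwap_isRowStochastic (e := fun r : Fin m => (((0 : Fin (K + 1)), (κ r).succ) : Fin (K + 1) × Fin (K + 1)))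
      (φ := fun _ => Equiv.refl S) hμ) hM hw0 hw1 ht0 ht1
  exact LevinPeres2017_lemma_6_16_worst hP (fun z => (tensorFun_pos hμ z).le) (sum_tensorFun_eq_one _ (fun _ => hν1)) n

/-- **`s(n) ≤ ε` AFTER `(2m/(t(1−t)c))·log((K+1)/(tε))` STEPS** — a whole-space Doeblin condition
`Pⁿ(x,·) ≥ (1−ε)·π̃` at the coupon-collector time. [ours] -/
theorem idealStar_sepDist_le_of_ge_log (hm : 1 ≤ m) (ht0 : 0 < t) (ht1 : t < 1) (hν : ∀ v, 0 < ν v)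
    (hν1 : ∑ v, ν v = 1) (hM : ∀ k, IsRowStochastic (M k)) (hM0 : ∀ u v, M 0 u v = ν v) {c : ℕ} (hc1 : 1 ≤ c)
    (hc : ∀ p : Fin K, c ≤ (univ.filter (fun r : Fin m => κ r = p)).card) (hcm : c ≤ m) {ε : ℝ} (hε : 0 < ε) {n : ℕ}
    (hn : 2 * (m : ℝ) / (t * (1 - t) * c) * Real.log (((K : ℝ) + 1) / (t * ε)) ≤ n) :
    sepDist (fun y z : Fin (K + 1) → S => t * ptGraphSwap (fun _ : Fin (K + 1) => ν)
          (fun r : Fin m => (((0 : Fin (K + 1)), (κ r).succ) : Fin (K + 1) × Fin (K + 1))) (fun _ => Equiv.refl S) y z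
          + (1 - t) * prodKernel (fun k : Fin (K + 1) => if k = 0 then (1 : ℝ) else 0) M y z)
        (tensorFun (fun _ : Fin (K + 1) => ν)) n ≤ ε := by
  set Q : Finset (Fin (K + 1)) → Finset (Fin (K + 1)) → ℝ := fun D D' => ∑ r : Fin m, t / m *
      (if D' = D.image (Equiv.swap (0 : Fin (K + 1)) (κ r).succ) then (1 : ℝ) else 0)
      + (1 - t) * (if D' = D.erase 0 then (1 : ℝ) else 0) with hQ_def
  have hQ : ∀ D D', Q D D' = ∑ r : Fin m, t / m * (if D' = D.image (Equiv.swap (0 : Fin (K + 1)) (κ r).succ) then (1 : ℝ)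
      else 0) + (1 - t) * (if D' = D.erase 0 then (1 : ℝ) else 0) := fun D D' => rfl
  have h2 := dirty_nonempty_le_of_ge_log κ hm ht0 ht1 hQ hc1 hc hcm hε hn
  have hbound : 0 ≤ ε := hε.le
  refine Real.iSup_le (fun x => Real.iSup_le (fun z => ?_) hbound) hbound
  have hπpos : 0 < tensorFun (fun _ : Fin (K + 1) => ν) z := tensorFun_pos (fun _ v => hν v) z
  -- pointwise: `Pⁿ(x,z) ≥ a_n(∅)·π̃(z)` and `1 − a_n(∅) = Σ_{D≠∅} ≤ ε`
  have hQst := dirty_isRowStochastic κ hm ht0.le ht1.le hQ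
  have hmassQ : ∑ D, lawAt Q (Pi.single (univ : Finset (Fin (K + 1))) 1) n D = 1 := by
    rw [sum_lawAt hQst, Finset.sum_pi_single', if_pos (mem_univ _)]
  have hsplit := Finset.sum_filter_add_sum_filter_not univ (fun D : Finset (Fin (K + 1)) => D ≠ ∅)
    (fun D => lawAt Q (Pi.single (univ : Finset (Fin (K + 1))) 1) n D)
  have hE : univ.filter (fun D : Finset (Fin (K + 1)) => ¬D ≠ ∅) = {∅} := by
    ext D; simp only [Finset.mem_filter, Finset.mem_univ, true_and, not_not, Finset.mem_singleton]
  rw [hmassQ, hE, Finset.sum_singleton] at hsplit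
  have hmin := ideal_minorization κ hm ht0.le ht1.le hν hν1 hM hM0 hQ x n z
  unfold kernelAt
  rw [sub_le_comm, le_div_iff₀ hπpos]
  calc (1 - ε) * tensorFun (fun _ : Fin (K + 1) => ν) z
      ≤ lawAt Q (Pi.single (univ : Finset (Fin (K + 1))) 1) n ∅ * tensorFun (fun _ : Fin (K + 1) => ν) z :=
        mul_le_mul_of_nonneg_right (by linarith) hπpos.le
    _ ≤ _ := hmin

end Sep

end Summit.Ventures.LatticeQCDFlow.Scaling

end
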